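import Literature.AlgebraicGeometry.Motives.MixedHodgeExtensionNonSeparatedGroup
import HarnessLib

/-!
# Extensions in the "wrong" weight order split: `Ext(A, B) = 0` when the sub `B` lies strictly above `A`

Brylinski–Zucker, Prop. 5.22: for arbitrary mixed Hodge structures
`Ext¹(A, B) ≅ Hom^W(A_ℂ, B_ℂ)/(Hom^W_F + Hom^W_ℚ) = J⁰W₀Hom(A, B)` (the tree's `Ext.extEquivJHomW`,
`Extension.isSplit_iff_clsW_eq_zero`). Carlson, *Extensions of mixed Hodge structures* (1980), §2,
treats the *separated* case — "the highest weight of `A` [the sub] is less than the lowest weight of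
`B` [the quotient]" — where `Ext` is the generalized torus `J⁰Hom(B, A)`; the non-trivial extensions of
Hodge theory (`0 → W_m H → H → H/W_m H → 0`) all have the sub BELOW the quotient.

This file records the complementary vanishing, for ARBITRARY carriers and no separation machinery:
**if for some `k` one has `W_k A = A` and `W_k B = 0` — every weight of the sub `B` is strictly larger
than every weight of the quotient `A` — then `Hom^W(A_ℂ, B_ℂ) = 0`** (a `W`-compatible `φ` maps
`A_ℂ = W_kA_ℂ` into `W_kB_ℂ = 0`), hence `J⁰W₀Hom(A, B) = 0`, **every extension
`0 → B → E → A → 0` of mixed `ℚ`-Hodge structures splits**, `Ext(A, B)` is a singleton, any two such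
extensions (any carriers) are congruent, and `Hom_MHS(A, B) = 0`. In particular an extension of a
pure Hodge structure of weight `n` by a pure Hodge structure of weight `n' > n` splits
(`Extension.isSplit_of_pure_lt`). (The opposite inequality is Carlson's separated case; equal pure
weights give `Ext(A, B) ≅ J⁰Hom(A, B)`, in general non-zero: `Ext(ℚ(-p), ℚ(-p)) ≅ ℂ/ℚ`,
`MixedHodgeExtensionTateByTate`.)

## Main results (all proved; no named facts)

* `homW_eq_bot_of_W`, `JHomW.eq_zero_of_W`, `Hom.eq_zero_of_W`.
* **`Extension.isSplit_of_W`**, `Extension.nonempty_congruence_of_W`, `Ext.eq_zeroW_of_W`,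
  `Ext.subsingleton_of_W`.
* Pure structures: `Extension.isSplit_of_pure_lt`, `Hom.eq_zero_of_pure_lt`, `Ext.subsingleton_of_pure_lt`.

## References

* [BrylinskiZucker1998] J.-L. Brylinski, S. Zucker, An overview of recent advances in Hodge theory,
  Prop. 5.22.
* [Carlson1980] J. A. Carlson, Extensions of mixed Hodge structures (1980), §2(b) (separated pairs),
  held text `book:beauvillend-proceedings-indo-french-conference-geometry`, PDF p. 89.
* [DeligneHodgeII1971] P. Deligne, Théorie de Hodge II, Thm. 2.3.5 (morphisms are strict).
-/

open scoped TensorProduct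

noncomputable section

namespace Literature.AlgebraicGeometry.Motives

namespace MixedHodgeStructure

open HodgeStructure (ofRat ofRat_apply)

universe u v w w'

variable {VA : Type u} [AddCommGroup VA] [Module ℚ VA]
variable {VB : Type v} [AddCommGroup VB] [Module ℚ VB]
variable {VE : Type w} [AddCommGroup VE] [Module ℚ VE]
variable {VE' : Type w'} [AddCommGroup VE'] [Module ℚ VE']

variable {A : MixedHodgeStructure VA} {B : MixedHodgeStructure VB} {k : ℤ}

omit [AddCommGroup VE] [Module ℚ VE] [AddCommGroup VE'] [Module ℚ VE'] in
/-- **`Hom^W(A_ℂ, B_ℂ) = 0` when `W_kA = A` and `W_kB = 0`**: a `W`-compatible `φ` maps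
`A_ℂ = W_kA_ℂ` into `W_kB_ℂ = 0`. [cite: BrylinskiZucker1998, Prop. 5.22] -/
theorem homW_eq_bot_of_W (hA : A.W k = ⊤) (hB : B.W k = ⊥) : homW A B = ⊥ := by
  rw [eq_bot_iff]
  intro φ hφ
  rw [Submodule.mem_bot]
  refine LinearMap.ext fun x => ?_
  have h := hφ k ⟨x, by rw [hA, Submodule.baseChange_top]; exact Submodule.mem_top, rfl⟩
  rw [hB, Submodule.baseChange_bot, Submodule.mem_bot] at h
  rw [LinearMap.zero_apply]
  exact h

omit [AddCommGroup VE] [Module ℚ VE] [AddCommGroup VE'] [Module ℚ VE'] in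
/-- **`J⁰W₀Hom(A, B) = 0` when `W_kA = A` and `W_kB = 0`.** [cite: BrylinskiZucker1998, Prop. 5.22] -/
theorem JHomW.eq_zero_of_W (hA : A.W k = ⊤) (hB : B.W k = ⊥) (c : JHomW A B) : c = 0 := by
  obtain ⟨φ, rfl⟩ := JHomW.mk_surjective c
  have h0 : homW A B = ⊥ := homW_eq_bot_of_W hA hB
  have hφ : φ = 0 := by
    apply Subtype.ext
    exact (Submodule.mem_bot ℂ).1 (h0 ▸ (φ.2 : (φ : ℂ ⊗[ℚ] VA →ₗ[ℂ] ℂ ⊗[ℚ] VB) ∈ homW A B))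
  rw [hφ, map_zero]

omit [AddCommGroup VE] [Module ℚ VE] [AddCommGroup VE'] [Module ℚ VE'] in
/-- **`Hom_MHS(A, B) = 0` when `W_kA = A` and `W_kB = 0`** (`f(A) = f(W_kA) ⊆ W_kB = 0`).
[cite: DeligneHodgeII1971, Thm. 2.3.5] -/
theorem Hom.eq_zero_of_W (hA : A.W k = ⊤) (hB : B.W k = ⊥) (f : Hom A B) : f = Hom.zero A B := by
  refine Hom.ext (LinearMap.ext fun x => ?_)
  have h := f.map_W_le k ⟨x, by rw [hA]; exact Submodule.mem_top, rfl⟩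
  rw [hB, Submodule.mem_bot] at h
  rw [h]
  rfl

omit [AddCommGroup VE'] [Module ℚ VE'] in
/-- **Every extension `0 → B → E → A → 0` with `W_kA = A`, `W_kB = 0` splits** — the sub lying in
weights strictly above the quotient, the refined class lives in `J⁰W₀Hom(A, B) = 0` (any carrier, any
pair; no separation hypothesis). [cite: BrylinskiZucker1998, Prop. 5.22] -/
theorem Extension.isSplit_of_W (hA : A.W k = ⊤) (hB : B.W k = ⊥) (E : Extension A B VE) : E.IsSplit :=
  Extension.isSplit_of_clsW_eq_zero (JHomW.eq_zero_of_W hA hB E.clsW)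

/-- Any two extensions of `A` by `B` with `W_kA = A`, `W_kB = 0` (any carriers) are congruent (both
split). [cite: BrylinskiZucker1998, Prop. 5.22] -/
theorem Extension.nonempty_congruence_of_W (hA : A.W k = ⊤) (hB : B.W k = ⊥) (E : Extension A B VE)
    (E' : Extension A B VE') : Nonempty (Congruence E E') :=
  (Extension.nonempty_congruence_iff_clsW_eq E E').2
    (by rw [JHomW.eq_zero_of_W hA hB E.clsW, JHomW.eq_zero_of_W hA hB E'.clsW])

omit [AddCommGroup VE] [Module ℚ VE] [AddCommGroup VE'] [Module ℚ VE'] in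
/-- Every class in `Ext(A, B)` is the split class when `W_kA = A`, `W_kB = 0`.
[cite: BrylinskiZucker1998, Prop. 5.22] -/
theorem Ext.eq_zeroW_of_W (hA : A.W k = ⊤) (hB : B.W k = ⊥) (x : Ext A B) : x = Ext.zeroW := by
  obtain ⟨E, rfl⟩ := Ext.mk_surjective x
  rw [← Ext.mkOfW_eq_mk, Ext.mkOfW_eq_zeroW_iff]
  exact Extension.isSplit_of_W hA hB E

omit [AddCommGroup VE] [Module ℚ VE] [AddCommGroup VE'] [Module ℚ VE'] in
/-- **`Ext(A, B) = 0`** (a singleton) when `W_kA = A`, `W_kB = 0`. [cite: BrylinskiZucker1998, Prop. 5.22] -/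
theorem Ext.subsingleton_of_W (hA : A.W k = ⊤) (hB : B.W k = ⊥) : Subsingleton (Ext A B) :=
  ⟨fun x y => by rw [Ext.eq_zeroW_of_W hA hB x, Ext.eq_zeroW_of_W hA hB y]⟩

/-! ### Pure Hodge structures of different weights -/

section Pure

variable {n n' : ℤ} (A' : HodgeStructure VA n) (B' : HodgeStructure VB n')

omit [AddCommGroup VB] [Module ℚ VB] [AddCommGroup VE] [Module ℚ VE] [AddCommGroup VE'] [Module ℚ VE'] in
/-- `W_n` of a pure Hodge structure of weight `n` is everything. [folklore] -/
private theorem pure_W_self_eq_top : A'.toMixedHodgeStructure.W n = ⊤ := by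
  rw [HodgeStructure.toMixedHodgeStructure_W, HodgeStructure.trivialWeightFiltration_of_le le_rfl]

omit [AddCommGroup VA] [Module ℚ VA] [AddCommGroup VE] [Module ℚ VE] [AddCommGroup VE'] [Module ℚ VE'] in
/-- `W_n` of a pure Hodge structure of weight `n' > n` is `0`. [folklore] -/
private theorem pure_W_eq_bot_of_lt (hn : n < n') : B'.toMixedHodgeStructure.W n = ⊥ := by
  rw [HodgeStructure.toMixedHodgeStructure_W, HodgeStructure.trivialWeightFiltration_of_lt hn]

omit [AddCommGroup VE'] [Module ℚ VE'] in
/-- **An extension of a pure Hodge structure of weight `n` by a pure Hodge structure of weight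
`n' > n` splits** (sub above quotient; the case `n' < n` is Carlson's separated theory, `n' = n` gives
`Ext ≅ J⁰Hom(A, B)`). [cite: BrylinskiZucker1998, Prop. 5.22] -/
theorem Extension.isSplit_of_pure_lt (hn : n < n')
    (E : Extension A'.toMixedHodgeStructure B'.toMixedHodgeStructure VE) : E.IsSplit :=
  Extension.isSplit_of_W (pure_W_self_eq_top A') (pure_W_eq_bot_of_lt B' hn) E

omit [AddCommGroup VE] [Module ℚ VE] [AddCommGroup VE'] [Module ℚ VE'] in
/-- There are no non-zero morphisms from a pure Hodge structure of weight `n` to one of weight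
`n' > n` (nor, dually, for `n' < n`: morphisms of MHS are strict; here the easy half).
[cite: DeligneHodgeII1971, Thm. 2.3.5] -/
theorem Hom.eq_zero_of_pure_lt (hn : n < n')
    (f : Hom A'.toMixedHodgeStructure B'.toMixedHodgeStructure) : f = Hom.zero _ _ :=
  Hom.eq_zero_of_W (pure_W_self_eq_top A') (pure_W_eq_bot_of_lt B' hn) f

omit [AddCommGroup VE] [Module ℚ VE] [AddCommGroup VE'] [Module ℚ VE'] in
/-- `Ext(A, B) = 0` for pure `A`, `B` of weights `n < n'`. [cite: BrylinskiZucker1998, Prop. 5.22] -/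
theorem Ext.subsingleton_of_pure_lt (hn : n < n') :
    Subsingleton (Ext A'.toMixedHodgeStructure B'.toMixedHodgeStructure) :=
  Ext.subsingleton_of_W (pure_W_self_eq_top A') (pure_W_eq_bot_of_lt B' hn)

end Pure

/-! ### Mixed by pure and pure by mixed -/

omit [AddCommGroup VE'] [Module ℚ VE'] in
/-- An extension of an MHS `A` of weights `≤ k` by a pure Hodge structure of weight `n' > k` splits.
[cite: BrylinskiZucker1998, Prop. 5.22] -/
theorem Extension.isSplit_of_W_eq_top_of_lt {n' : ℤ} (B' : HodgeStructure VB n') (hA : A.W k = ⊤)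
    (hk : k < n') (E : Extension A B'.toMixedHodgeStructure VE) : E.IsSplit :=
  Extension.isSplit_of_W hA
    (by rw [HodgeStructure.toMixedHodgeStructure_W, HodgeStructure.trivialWeightFiltration_of_lt hk]) E

omit [AddCommGroup VE'] [Module ℚ VE'] in
/-- An extension of a pure Hodge structure of weight `n` by an MHS `B` of weights `> n` (`W_nB = 0`)
splits. [cite: BrylinskiZucker1998, Prop. 5.22] -/
theorem Extension.isSplit_of_pure_of_W_eq_bot {n : ℤ} (A' : HodgeStructure VA n) (hB : B.W n = ⊥)
    (E : Extension A'.toMixedHodgeStructure B VE) : E.IsSplit :=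
  Extension.isSplit_of_W
    (by rw [HodgeStructure.toMixedHodgeStructure_W, HodgeStructure.trivialWeightFiltration_of_le le_rfl])
    hB E

end MixedHodgeStructure

end Literature.AlgebraicGeometry.Motives

end
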